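import Literature.AlgebraicGeometry.Deformation.SmoothSchemeLiftObstructionCriterionGlueDatum
import Literature.AlgebraicGeometry.Motives.ThickeningModelNaturality
import HarnessLib

/-!
# Gluing the lifted charts, VI-a: an exact twisted unit cocycle read on the glued deformation — the overlap sections and their cocycle
# (Hartshorne, *Deformation Theory*, Thm. 6.4 (a) in the gluing dialect of Thm. 10.2; *Algebraic Geometry* II Ex. 5.18 (b))

Layer `Literature/AlgebraicGeometry/Deformation` (cell `hodgecm-mathlib`, F-11 sub-line `F11SmoothRoadA`, α1 grandchild
`F11LiftWithLineBundle`, stub G2 dictionary D1 «twisted exact unit cocycle ↦ rank-one module on the glued lift»; FILE 1 of 2;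
THEOREMS ONLY — no definition, no instance, no notation, no named fact).  Sequel of the glue datum FILE
`Deformation/SmoothSchemeLiftObstructionCriterionGlueDatum` (`chartProj`, `chartOverlap`, `overlapRingHom`, `baseChangeRight`,
`transitionMap`, `deformationGlueDatum`), whose `variable`s are repeated VERBATIM: the closed fibre `X/Spec k` with its `k`-structures
`halg`, a commutative `k`-algebra `R` of coefficients with a nilpotent ideal `𝔫`, a principal affine cover `U j`, `U j ∩ U l = D(b j l)`,
cocycle-exact lifted transition automorphisms `ψ j l` of `R ⊗_k Γ(U j ∩ U l)` (`hψ`, `hcoc`); `X' := (deformationGlueDatum …).glueData.glued`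
is THE GLUED DEFORMATION with its open immersions `ι j : C j = Spec (R ⊗_k Γ(U j)) ⟶ X'`.

THE NEW DATA: `G j l ∈ R ⊗_k Γ(U j ∩ U l)` — lifted transition UNITS of an invertible sheaf trivialised on the charts (the output of
`Deformation/PairLiftTwistedCocycleObstruction` §2 / `…PairLiftObstructionMove`: corrected units with twisted defect EXACTLY `1`).

* §0 the chart images `ι j (C j)` and their intersections: `(ι j)⁻¹(ι l (C l)) = W j l` (★ `OpensGlueDatum.preimage_range_ι`),
  `ι j (C j) ∩ ι l (C l) = ι j (W j l)`, and READING a section of `X'` over `ι j (C j) ∩ ι l (C l)` in the chart `j` (`appLE` along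
  `W j l ↪ C j ↪ X'`) is bijective.
* §1 **`exists_overlapSections`**: sections `g_{jl} ∈ Γ(X', ι j (C j) ∩ ι l (C l))` whose chart-`j` reading is `Λ_{jl} (G j l)`; unique.
* §2 **`overlapSection_mul`** — THE COCYCLE: if the `G j l` satisfy the TWISTED cocycle identity
  `Φjm (G j m) = Φjl (G j l) · τjl (Φlm (G l m))` on `R ⊗_k Γ(U j ∩ U l ∩ U m)` for all characterised base changes `Φ` and every
  `τjl` with `τjl (Φjl (ψ j l x)) = Φjl x` (the restriction of `(ψ j l)⁻¹` — the glue datum's transition `t j l = Spec (Λ_{jl} ∘ (ψ j l)⁻¹ ∘ Φ)`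
  reads chart-`l` functions in chart `j` through it, FILE 1c `comp_chartRingHom_of_transition`), then
  `g_{jl}| · g_{lm}| = g_{jm}|` on `ι j (C j) ∩ ι l (C l) ∩ ι m (C m)`.  The hypothesis is, binder for binder, the second conjunct of
  `Deformation/PairLiftTwistedCocycleObstruction.exact_correctedUnits_of_pairObstructionCochain_eq` (with `A' := R`).

The module itself (units, `g_{jj} = 1`, the rank-one module with frames on the chart images and transition functions `g_{jl}`) is the
sequel `Deformation/SmoothSchemeLiftObstructionCriterionGlueLineBundle`.  HC_CM is proved only modulo the 7 printed citations until
rung 0 closes — nothing here bears on a summit statement.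

## References
* [Hartshorne2010] R. Hartshorne, *Deformation Theory*, GTM 257, Springer (2010): Thm. 6.4 (a) and its proof (pp. 50–51); Thm. 10.2 (a)
  proof (p. 81).
* [Hartshorne1977] R. Hartshorne, *Algebraic Geometry*, GTM 52 (1977): II Ex. 1.22 (glueing sheaves), II Ex. 2.12 (glueing schemes),
  II Ex. 5.18 (b) (locally free sheaves from transition data).
* [StacksProject] The Stacks Project, Tag 01JA (glueing schemes).
* [GortzWedhorn2020] U. Görtz, T. Wedhorn, *Algebraic Geometry I*, 2nd ed. (2020), Section (3.5) Prop. 3.10.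
-/

noncomputable section

-- `TopCat.Presheaf`/`TopCat.Sheaf` are not reducible (as in Mathlib's `AlgebraicGeometry/Modules`).
set_option backward.isDefEq.respectTransparency false

open CategoryTheory AlgebraicGeometry Opposite TopologicalSpace Limits
open scoped TensorProduct

universe u

namespace Literature.AlgebraicGeometry.Deformation

section D1A1

open Literature.AlgebraicGeometry.Motives Literature.AlgebraicGeometry.Morphisms Literature.AlgebraicGeometry.Modules

variable {k : Type u} [Field k] {X : Over (Spec (CommRingCat.of k))}
  [instΓ : ∀ W : X.left.Opens, Algebra k Γ(X.left, W)]
  (halg : ∀ (W : X.left.Opens) (s : k), algebraMap k Γ(X.left, W) s = (constToPresheaf X).app (op W) s)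
  (R : Type u) [CommRing R] [Algebra k R]
  {ι : Type u} (U : ι → X.left.affineOpens) (b : (j l : ι) → Γ(X.left, (U j).1))
  (hb : ∀ j l, (U j).1 ⊓ (U l).1 = X.left.basicOpen (b j l))
  (ψ : (j l : ι) → R ⊗[k] Γ(X.left, (U j).1 ⊓ (U l).1) ≃ₐ[R] R ⊗[k] Γ(X.left, (U j).1 ⊓ (U l).1))
  (𝔫 : Ideal R) (h𝔫 : IsNilpotent 𝔫)
  (hψ : ∀ j l x, ψ j l x - x ∈ 𝔫 • (⊤ : Submodule R (R ⊗[k] Γ(X.left, (U j).1 ⊓ (U l).1))))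
  (hcoc : ∀ (j l m : ι)
    (Φjl : R ⊗[k] Γ(X.left, (U j).1 ⊓ (U l).1) →ₐ[R] R ⊗[k] Γ(X.left, (U j).1 ⊓ (U l).1 ⊓ (U m).1))
    (_ : ∀ a s, Φjl (a ⊗ₜ s) = a ⊗ₜ X.left.presheaf.map (homOfLE inf_le_left).op s)
    (Φlm : R ⊗[k] Γ(X.left, (U l).1 ⊓ (U m).1) →ₐ[R] R ⊗[k] Γ(X.left, (U j).1 ⊓ (U l).1 ⊓ (U m).1))
    (_ : ∀ a s, Φlm (a ⊗ₜ s) = a ⊗ₜ X.left.presheaf.map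
      (homOfLE (le_inf (inf_le_left.trans inf_le_right) inf_le_right)).op s)
    (Φjm : R ⊗[k] Γ(X.left, (U j).1 ⊓ (U m).1) →ₐ[R] R ⊗[k] Γ(X.left, (U j).1 ⊓ (U l).1 ⊓ (U m).1))
    (_ : ∀ a s, Φjm (a ⊗ₜ s) = a ⊗ₜ X.left.presheaf.map
      (homOfLE (le_inf (inf_le_left.trans inf_le_left) inf_le_right)).op s)
    (ρjl ρlm ρjm : R ⊗[k] Γ(X.left, (U j).1 ⊓ (U l).1 ⊓ (U m).1) ≃ₐ[R]
      R ⊗[k] Γ(X.left, (U j).1 ⊓ (U l).1 ⊓ (U m).1)),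
    (∀ x, ρjl (Φjl x) = Φjl (ψ j l x)) → (∀ x, ρlm (Φlm x) = Φlm (ψ l m x)) →
    (∀ x, ρjm (Φjm x) = Φjm (ψ j m x)) → ρlm * ρjl = ρjm)

/-! ## §0 The chart images of the glued deformation and their pairwise intersections -/

include hb h𝔫 hψ in
/-- On the glued deformation `X'`, the part of chart `j` meeting the image of chart `l` is the overlap
`W j l = chartProj_j⁻¹(U j ∩ U l)`: `(ι j)⁻¹(ι l (C l)) = W j l`. [cite: StacksProject, Tag 01JA] -/
theorem glued_preimage_opensRange (j l : ι) :
    (deformationGlueDatum halg R U b hb ψ 𝔫 h𝔫 hψ hcoc).glueData.ι j ⁻¹ᵁ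
        ((deformationGlueDatum halg R U b hb ψ 𝔫 h𝔫 hψ hcoc).glueData.ι l).opensRange =
      chartOverlap R U j l :=
  TopologicalSpace.Opens.ext
    (OpensGlueDatum.preimage_range_ι (deformationGlueDatum halg R U b hb ψ 𝔫 h𝔫 hψ hcoc) l j)

include hb h𝔫 hψ in
/-- The intersection of the images of the charts `j` and `l` is the image of the overlap `W j l` of chart `j`.
[cite: StacksProject, Tag 01JA] [cite: GortzWedhorn2020, Section (3.5) Proposition 3.10] -/
theorem opensRange_inf_opensRange_eq (j l : ι) :
    ((deformationGlueDatum halg R U b hb ψ 𝔫 h𝔫 hψ hcoc).glueData.ι j).opensRange ⊓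
        ((deformationGlueDatum halg R U b hb ψ 𝔫 h𝔫 hψ hcoc).glueData.ι l).opensRange =
      (deformationGlueDatum halg R U b hb ψ 𝔫 h𝔫 hψ hcoc).glueData.ι j ''ᵁ chartOverlap R U j l := by
  rw [← glued_preimage_opensRange halg R U b hb ψ 𝔫 h𝔫 hψ hcoc j l, Scheme.Hom.image_preimage_eq_opensRange_inf]

include hb h𝔫 hψ in
/-- The open subscheme `W j l` of chart `j` maps into the intersection of the chart images `j` and `l`.
[cite: StacksProject, Tag 01JA] -/
theorem top_le_preimage_opensRange_inf (j l : ι) :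
    ⊤ ≤ ((chartOverlap R U j l).ι ≫ (deformationGlueDatum halg R U b hb ψ 𝔫 h𝔫 hψ hcoc).glueData.ι j) ⁻¹ᵁ
      (((deformationGlueDatum halg R U b hb ψ 𝔫 h𝔫 hψ hcoc).glueData.ι j).opensRange ⊓
        ((deformationGlueDatum halg R U b hb ψ 𝔫 h𝔫 hψ hcoc).glueData.ι l).opensRange) := by
  rw [Scheme.Hom.comp_preimage, Scheme.Hom.preimage_inf, Scheme.Hom.preimage_opensRange,
    glued_preimage_opensRange halg R U b hb ψ 𝔫 h𝔫 hψ hcoc j l, top_inf_eq, Scheme.Opens.ι_preimage_self]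

include hb h𝔫 hψ in
/-- The image of `W j l ↪ C j ↪ X'` is exactly the intersection of the chart images `j` and `l`.
[cite: StacksProject, Tag 01JA] -/
theorem opensRange_overlap_ι_comp_ι (j l : ι) :
    ((chartOverlap R U j l).ι ≫ (deformationGlueDatum halg R U b hb ψ 𝔫 h𝔫 hψ hcoc).glueData.ι j).opensRange =
      ((deformationGlueDatum halg R U b hb ψ 𝔫 h𝔫 hψ hcoc).glueData.ι j).opensRange ⊓
        ((deformationGlueDatum halg R U b hb ψ 𝔫 h𝔫 hψ hcoc).glueData.ι l).opensRange := by
  rw [Scheme.Hom.opensRange_comp, Scheme.Opens.opensRange_ι, opensRange_inf_opensRange_eq]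

/-- `appLE U ⊤` of a morphism whose range is `U` is an isomorphism (open immersions induce isomorphisms on the
sections over opens of their range). [cite: Hartshorne1977, II Ex. 2.12 (glueing; sections on the pieces)] -/
theorem isIso_appLE_top_of_opensRange_eq {Y Z : Scheme.{u}} (f : Y ⟶ Z) [IsOpenImmersion f] (V : Z.Opens)
    (hV : f.opensRange = V) (h : ⊤ ≤ f ⁻¹ᵁ V) : IsIso (f.appLE V ⊤ h) := by
  have h1 : IsIso (f.app V) := Scheme.Hom.isIso_app f V hV.ge
  have h2 : (⊤ : Y.Opens) = f ⁻¹ᵁ V := le_antisymm h le_top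
  have h3 : (homOfLE h : (⊤ : Y.Opens) ⟶ f ⁻¹ᵁ V) = (eqToIso h2).hom := Subsingleton.elim _ _
  rw [Scheme.Hom.appLE, h3]
  infer_instance

include hb h𝔫 hψ in
/-- Reading a section of `X'` over `ι j (C j) ∩ ι l (C l)` in the chart `j` (over `W j l`) is bijective.
[cite: StacksProject, Tag 01JA] -/
theorem appLE_overlap_bijective (j l : ι) :
    Function.Bijective (((chartOverlap R U j l).ι ≫
        (deformationGlueDatum halg R U b hb ψ 𝔫 h𝔫 hψ hcoc).glueData.ι j).appLE
      (((deformationGlueDatum halg R U b hb ψ 𝔫 h𝔫 hψ hcoc).glueData.ι j).opensRange ⊓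
        ((deformationGlueDatum halg R U b hb ψ 𝔫 h𝔫 hψ hcoc).glueData.ι l).opensRange) ⊤
      (top_le_preimage_opensRange_inf halg R U b hb ψ 𝔫 h𝔫 hψ hcoc j l)) := by
  haveI := isIso_appLE_top_of_opensRange_eq _ _ (opensRange_overlap_ι_comp_ι halg R U b hb ψ 𝔫 h𝔫 hψ hcoc j l)
    (top_le_preimage_opensRange_inf halg R U b hb ψ 𝔫 h𝔫 hψ hcoc j l)
  exact ConcreteCategory.bijective_of_isIso _

/-! ## §1 The overlap sections `g_{jl}`: the sections over `ι j (C j) ∩ ι l (C l)` whose chart-`j` reading is `G j l` -/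

variable (G : (j l : ι) → R ⊗[k] Γ(X.left, (U j).1 ⊓ (U l).1))

include hb h𝔫 hψ in
/-- **The overlap sections**: there are sections `g_{jl} ∈ Γ(X', ι j (C j) ∩ ι l (C l))` whose reading in the chart `j`
(over `W j l`, through the chart ring map `Λ_{jl}`) is the given `G j l ∈ R ⊗_k Γ(U j ∩ U l)`.
[cite: Hartshorne2010, Thm. 6.4 (a) (proof, pp. 50–51)] [cite: Hartshorne1977, II Ex. 5.18 (b)] -/
theorem exists_overlapSections :
    ∃ s : (j l : ι) →
        Γ((deformationGlueDatum halg R U b hb ψ 𝔫 h𝔫 hψ hcoc).glueData.glued,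
          ((deformationGlueDatum halg R U b hb ψ 𝔫 h𝔫 hψ hcoc).glueData.ι j).opensRange ⊓
            ((deformationGlueDatum halg R U b hb ψ 𝔫 h𝔫 hψ hcoc).glueData.ι l).opensRange),
      ∀ j l, ((chartOverlap R U j l).ι ≫ (deformationGlueDatum halg R U b hb ψ 𝔫 h𝔫 hψ hcoc).glueData.ι j).appLE
          (((deformationGlueDatum halg R U b hb ψ 𝔫 h𝔫 hψ hcoc).glueData.ι j).opensRange ⊓
            ((deformationGlueDatum halg R U b hb ψ 𝔫 h𝔫 hψ hcoc).glueData.ι l).opensRange) ⊤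
          (top_le_preimage_opensRange_inf halg R U b hb ψ 𝔫 h𝔫 hψ hcoc j l) (s j l) =
        overlapRingHom halg R U j l (G j l) :=
  ⟨fun j l => ((appLE_overlap_bijective halg R U b hb ψ 𝔫 h𝔫 hψ hcoc j l).2 (overlapRingHom halg R U j l (G j l))).choose,
    fun j l => ((appLE_overlap_bijective halg R U b hb ψ 𝔫 h𝔫 hψ hcoc j l).2
      (overlapRingHom halg R U j l (G j l))).choose_spec⟩

include hb h𝔫 hψ in
/-- The overlap sections are unique (the chart reading is injective). [cite: Hartshorne1977, II Ex. 5.18 (b)] -/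
theorem overlapSection_unique {j l : ι}
    {s s' : Γ((deformationGlueDatum halg R U b hb ψ 𝔫 h𝔫 hψ hcoc).glueData.glued,
      ((deformationGlueDatum halg R U b hb ψ 𝔫 h𝔫 hψ hcoc).glueData.ι j).opensRange ⊓
        ((deformationGlueDatum halg R U b hb ψ 𝔫 h𝔫 hψ hcoc).glueData.ι l).opensRange)}
    (h : ((chartOverlap R U j l).ι ≫ (deformationGlueDatum halg R U b hb ψ 𝔫 h𝔫 hψ hcoc).glueData.ι j).appLE
          (((deformationGlueDatum halg R U b hb ψ 𝔫 h𝔫 hψ hcoc).glueData.ι j).opensRange ⊓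
            ((deformationGlueDatum halg R U b hb ψ 𝔫 h𝔫 hψ hcoc).glueData.ι l).opensRange) ⊤
          (top_le_preimage_opensRange_inf halg R U b hb ψ 𝔫 h𝔫 hψ hcoc j l) s =
        ((chartOverlap R U j l).ι ≫ (deformationGlueDatum halg R U b hb ψ 𝔫 h𝔫 hψ hcoc).glueData.ι j).appLE
          (((deformationGlueDatum halg R U b hb ψ 𝔫 h𝔫 hψ hcoc).glueData.ι j).opensRange ⊓
            ((deformationGlueDatum halg R U b hb ψ 𝔫 h𝔫 hψ hcoc).glueData.ι l).opensRange) ⊤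
          (top_le_preimage_opensRange_inf halg R U b hb ψ 𝔫 h𝔫 hψ hcoc j l) s') : s = s' :=
  (appLE_overlap_bijective halg R U b hb ψ 𝔫 h𝔫 hψ hcoc j l).1 h


/-! ## §2 The cocycle of the overlap sections (the twisted cocycle identity read on the glued scheme) -/

variable
  (hGcoc : ∀ (j l m : ι)
    (Φjl : R ⊗[k] Γ(X.left, (U j).1 ⊓ (U l).1) →ₐ[R] R ⊗[k] Γ(X.left, (U j).1 ⊓ (U l).1 ⊓ (U m).1))
    (_ : ∀ a s, Φjl (a ⊗ₜ s) = a ⊗ₜ X.left.presheaf.map (homOfLE inf_le_left).op s)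
    (Φlm : R ⊗[k] Γ(X.left, (U l).1 ⊓ (U m).1) →ₐ[R] R ⊗[k] Γ(X.left, (U j).1 ⊓ (U l).1 ⊓ (U m).1))
    (_ : ∀ a s, Φlm (a ⊗ₜ s) = a ⊗ₜ X.left.presheaf.map
      (homOfLE (le_inf (inf_le_left.trans inf_le_right) inf_le_right)).op s)
    (Φjm : R ⊗[k] Γ(X.left, (U j).1 ⊓ (U m).1) →ₐ[R] R ⊗[k] Γ(X.left, (U j).1 ⊓ (U l).1 ⊓ (U m).1))
    (_ : ∀ a s, Φjm (a ⊗ₜ s) = a ⊗ₜ X.left.presheaf.map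
      (homOfLE (le_inf (inf_le_left.trans inf_le_left) inf_le_right)).op s)
    (τjl : R ⊗[k] Γ(X.left, (U j).1 ⊓ (U l).1 ⊓ (U m).1) ≃ₐ[R] R ⊗[k] Γ(X.left, (U j).1 ⊓ (U l).1 ⊓ (U m).1)),
    (∀ x, τjl (Φjl (ψ j l x)) = Φjl x) → Φjm (G j m) = Φjl (G j l) * τjl (Φlm (G l m)))

include hb h𝔫 hψ hGcoc in
set_option maxHeartbeats 800000 in -- three chart ring maps + one transition reading (as FILE 1c `transition_cocycle`)
/-- **THE COCYCLE OF THE OVERLAP SECTIONS.**  If the `G j l ∈ R ⊗_k Γ(U j ∩ U l)` satisfy the TWISTED cocycle identity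
`Φjm (G j m) = Φjl (G j l) · τjl (Φlm (G l m))` on `R ⊗_k Γ(U j ∩ U l ∩ U m)` — the unit of chart `l` read in chart `j`
through the restriction `τjl` of `(ψ j l)⁻¹`, exactly as the glue datum's transition map `t j l = Spec (Λ_{jl} ∘ (ψ j l)⁻¹ ∘ Φ)`
reads chart-`l` functions in chart `j` — then the overlap sections `g_{jl}` of `X'` satisfy the honest cocycle identity
`g_{jl}| · g_{lm}| = g_{jm}|` on `ι j (C j) ∩ ι l (C l) ∩ ι m (C m)` (Hartshorne II Ex. 5.18 (b): transition data of a
line bundle; the deformation reading is Thm. 6.4 (a) of *Deformation Theory*).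
[cite: Hartshorne2010, Thm. 6.4 (a) (proof, pp. 50–51)] [cite: Hartshorne1977, II Ex. 5.18 (b)] [cite: StacksProject, Tag 01JA] -/
theorem overlapSection_mul
    (s : (j l : ι) →
      Γ((deformationGlueDatum halg R U b hb ψ 𝔫 h𝔫 hψ hcoc).glueData.glued,
        ((deformationGlueDatum halg R U b hb ψ 𝔫 h𝔫 hψ hcoc).glueData.ι j).opensRange ⊓
          ((deformationGlueDatum halg R U b hb ψ 𝔫 h𝔫 hψ hcoc).glueData.ι l).opensRange))
    (hs : ∀ j l, ((chartOverlap R U j l).ι ≫ (deformationGlueDatum halg R U b hb ψ 𝔫 h𝔫 hψ hcoc).glueData.ι j).appLE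
        (((deformationGlueDatum halg R U b hb ψ 𝔫 h𝔫 hψ hcoc).glueData.ι j).opensRange ⊓
          ((deformationGlueDatum halg R U b hb ψ 𝔫 h𝔫 hψ hcoc).glueData.ι l).opensRange) ⊤
        (top_le_preimage_opensRange_inf halg R U b hb ψ 𝔫 h𝔫 hψ hcoc j l) (s j l) =
      overlapRingHom halg R U j l (G j l))
    (j l m : ι) :
    (deformationGlueDatum halg R U b hb ψ 𝔫 h𝔫 hψ hcoc).glueData.glued.presheaf.map
        (homOfLE (inf_le_left :
          ((deformationGlueDatum halg R U b hb ψ 𝔫 h𝔫 hψ hcoc).glueData.ι j).opensRange ⊓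
              ((deformationGlueDatum halg R U b hb ψ 𝔫 h𝔫 hψ hcoc).glueData.ι l).opensRange ⊓
              ((deformationGlueDatum halg R U b hb ψ 𝔫 h𝔫 hψ hcoc).glueData.ι m).opensRange ≤
            ((deformationGlueDatum halg R U b hb ψ 𝔫 h𝔫 hψ hcoc).glueData.ι j).opensRange ⊓
              ((deformationGlueDatum halg R U b hb ψ 𝔫 h𝔫 hψ hcoc).glueData.ι l).opensRange)).op (s j l) *
      (deformationGlueDatum halg R U b hb ψ 𝔫 h𝔫 hψ hcoc).glueData.glued.presheaf.map
        (homOfLE (le_inf (inf_le_left.trans inf_le_right) inf_le_right :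
          ((deformationGlueDatum halg R U b hb ψ 𝔫 h𝔫 hψ hcoc).glueData.ι j).opensRange ⊓
              ((deformationGlueDatum halg R U b hb ψ 𝔫 h𝔫 hψ hcoc).glueData.ι l).opensRange ⊓
              ((deformationGlueDatum halg R U b hb ψ 𝔫 h𝔫 hψ hcoc).glueData.ι m).opensRange ≤
            ((deformationGlueDatum halg R U b hb ψ 𝔫 h𝔫 hψ hcoc).glueData.ι l).opensRange ⊓
              ((deformationGlueDatum halg R U b hb ψ 𝔫 h𝔫 hψ hcoc).glueData.ι m).opensRange)).op (s l m) =
      (deformationGlueDatum halg R U b hb ψ 𝔫 h𝔫 hψ hcoc).glueData.glued.presheaf.map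
        (homOfLE (le_inf (inf_le_left.trans inf_le_left) inf_le_right :
          ((deformationGlueDatum halg R U b hb ψ 𝔫 h𝔫 hψ hcoc).glueData.ι j).opensRange ⊓
              ((deformationGlueDatum halg R U b hb ψ 𝔫 h𝔫 hψ hcoc).glueData.ι l).opensRange ⊓
              ((deformationGlueDatum halg R U b hb ψ 𝔫 h𝔫 hψ hcoc).glueData.ι m).opensRange ≤
            ((deformationGlueDatum halg R U b hb ψ 𝔫 h𝔫 hψ hcoc).glueData.ι j).opensRange ⊓
              ((deformationGlueDatum halg R U b hb ψ 𝔫 h𝔫 hψ hcoc).glueData.ι m).opensRange)).op (s j m) := by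
  -- §A the base changes to the triple intersection, the restriction `ρjl` of `ψ j l`, and the twisted identity
  have hV'jl : (U j).1 ⊓ (U l).1 ⊓ (U m).1 ≤ (U j).1 ⊓ (U l).1 := inf_le_left
  have hV'lm : (U j).1 ⊓ (U l).1 ⊓ (U m).1 ≤ (U l).1 ⊓ (U m).1 :=
    le_inf (inf_le_left.trans inf_le_right) inf_le_right
  have hV'jm : (U j).1 ⊓ (U l).1 ⊓ (U m).1 ≤ (U j).1 ⊓ (U m).1 :=
    le_inf (inf_le_left.trans inf_le_left) inf_le_right
  obtain ⟨Φjl, hΦjl⟩ := exists_baseChangeMap (A' := R) halg ((U j).1 ⊓ (U l).1) ((U j).1 ⊓ (U l).1 ⊓ (U m).1) hV'jl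
  obtain ⟨Φlm, hΦlm⟩ := exists_baseChangeMap (A' := R) halg ((U l).1 ⊓ (U m).1) ((U j).1 ⊓ (U l).1 ⊓ (U m).1) hV'lm
  obtain ⟨Φjm, hΦjm⟩ := exists_baseChangeMap (A' := R) halg ((U j).1 ⊓ (U m).1) ((U j).1 ⊓ (U l).1 ⊓ (U m).1) hV'jm
  obtain ⟨ρjl, hρjl, -⟩ := exists_algEquiv_restrict (A' := R) halg 𝔫 (V := (U j).1 ⊓ (U l).1)
    (W := (U j).1 ⊓ (U l).1 ⊓ (U m).1) (isAffineOpen_inf₂ U b hb j l)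
    (X.left.presheaf.map (homOfLE (inf_le_left : (U j).1 ⊓ (U l).1 ≤ (U j).1)).op (b j m))
    (inf_eq_basicOpen_map U b hb inf_le_left m) hV'jl h𝔫 (ψ j l) (hψ j l) (Φ := Φjl) hΦjl
  have hG : Φjm (G j m) = Φjl (G j l) * ρjl.symm (Φlm (G l m)) :=
    hGcoc j l m Φjl hΦjl Φlm hΦlm Φjm hΦjm ρjl.symm (fun x => by rw [AlgEquiv.symm_apply_eq, hρjl])
  -- §B the open `O = W j l ∩ W j m` of chart `j`; its inclusions `a`, `c` and its transition `b'` into `W l m`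
  obtain ⟨O, hOdef⟩ : ∃ O : (Spec (CommRingCat.of (R ⊗[k] Γ(X.left, (U j).1)))).Opens,
      O = chartOverlap R U j l ⊓ chartOverlap R U j m := ⟨_, rfl⟩
  have hOjl : O ≤ chartOverlap R U j l := hOdef ▸ inf_le_left
  have hOjm : O ≤ chartOverlap R U j m := hOdef ▸ inf_le_right
  obtain ⟨a, ha⟩ : ∃ a : (O : Scheme.{u}) ⟶ (chartOverlap R U j l : (Spec (CommRingCat.of
      (R ⊗[k] Γ(X.left, (U j).1)))).Opens), a ≫ (chartOverlap R U j l).ι = O.ι :=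
    ⟨Scheme.homOfLE _ hOjl, Scheme.homOfLE_ι _ _⟩
  obtain ⟨c, hc⟩ : ∃ c : (O : Scheme.{u}) ⟶ (chartOverlap R U j m : (Spec (CommRingCat.of
      (R ⊗[k] Γ(X.left, (U j).1)))).Opens), c ≫ (chartOverlap R U j m).ι = O.ι :=
    ⟨Scheme.homOfLE _ hOjm, Scheme.homOfLE_ι _ _⟩
  have hrange : Set.range (a ≫ transitionMap halg R U ψ j l) ⊆ Set.range (chartOverlap R U l m).ι := by
    rintro _ ⟨x, rfl⟩
    rw [Scheme.Opens.range_ι]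
    have hx : ((chartOverlap R U j l).ι (a x)) ∈ chartOverlap R U j m := by
      rw [← Scheme.Hom.comp_apply, ha, Scheme.Opens.ι_apply]
      exact hOjm x.2
    exact (deformationGlueDatum halg R U b hb ψ 𝔫 h𝔫 hψ hcoc).dom j l m (a x) hx
  obtain ⟨b', hb'⟩ : ∃ b' : (O : Scheme.{u}) ⟶ (chartOverlap R U l m : (Spec (CommRingCat.of
      (R ⊗[k] Γ(X.left, (U l).1)))).Opens), b' ≫ (chartOverlap R U l m).ι = a ≫ transitionMap halg R U ψ j l :=
    ⟨IsOpenImmersion.lift _ _ hrange, IsOpenImmersion.lift_fac _ _ hrange⟩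
  have hb'' : b' ≫ (chartOverlap R U l m).ι = a ≫ ((chartOverlap R U j l : (Spec (CommRingCat.of
      (R ⊗[k] Γ(X.left, (U j).1)))).Opens) : Scheme.{u}).toSpecΓ ≫ Spec.map (CommRingCat.ofHom
      ((overlapRingHom halg R U j l).comp
        ((ψ j l).symm.toAlgHom.toRingHom.comp (baseChangeRight halg R U j l).toRingHom))) := by
    rw [hb', transitionMap_eq]
  -- §C the chart ring map of `O` over `U j ∩ U l ∩ U m` and the three readings
  have hO : ⊤ ≤ (O.ι ≫ chartProj R U j) ⁻¹ᵁ ((U j).1 ⊓ (U l).1 ⊓ (U m).1) := by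
    intro x _
    change chartProj R U j (O.ι x) ∈ (U j).1 ⊓ (U l).1 ⊓ (U m).1
    rw [Scheme.Opens.ι_apply]
    exact ⟨hOjl x.2, (hOjm x.2).2⟩
  have hO₁ : ⊤ ≤ (O.ι ≫ chartProj R U j) ⁻¹ᵁ ((U j).1 ⊓ (U l).1) := fun x hx => hV'jl (hO hx)
  have hO₂ : ⊤ ≤ (O.ι ≫ chartProj R U j) ⁻¹ᵁ ((U j).1 ⊓ (U m).1) := fun x hx => hV'jm (hO hx)
  obtain ⟨ΛO, hΛO, hΛO'⟩ := exists_chartRingHom halg (U j).2 (chartProj R U j) rfl O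
    ((inf_le_left.trans inf_le_left : (U j).1 ⊓ (U l).1 ⊓ (U m).1 ≤ (U j).1)) hO
  obtain ⟨ΛO₁, hΛO₁, hΛO₁'⟩ := exists_chartRingHom halg (U j).2 (chartProj R U j) rfl O
    (inf_le_left : (U j).1 ⊓ (U l).1 ≤ (U j).1) hO₁
  obtain ⟨ΛO₂, hΛO₂, hΛO₂'⟩ := exists_chartRingHom halg (U j).2 (chartProj R U j) rfl O
    (inf_le_left : (U j).1 ⊓ (U m).1 ≤ (U j).1) hO₂
  have ejl : a.appTop.hom.comp (overlapRingHom halg R U j l) = ΛO.comp Φjl.toRingHom :=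
    (comp_chartRingHom (chartProj R U j) a ha (overlapRingHom_tmul_one halg R U j l)
      (overlapRingHom_one_tmul halg R U j l) hΛO₁ hΛO₁').trans
      (chartRingHom_comp_baseChange (chartProj R U j) hV'jl hΛO₁ hΛO₁' hΛO hΛO' hΦjl).symm
  have ejm : c.appTop.hom.comp (overlapRingHom halg R U j m) = ΛO.comp Φjm.toRingHom :=
    (comp_chartRingHom (chartProj R U j) c hc (overlapRingHom_tmul_one halg R U j m)
      (overlapRingHom_one_tmul halg R U j m) hΛO₂ hΛO₂').trans
      (chartRingHom_comp_baseChange (chartProj R U j) hV'jm hΛO₂ hΛO₂' hΛO hΛO' hΦjm).symm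
  have hψjl : ∀ x, IsNilpotent (ψ j l x - x) := fun x =>
    SmoothAffineDeformation.isNilpotent_of_mem_smul_top 𝔫 h𝔫 (hψ j l x)
  have elm : b'.appTop.hom.comp (overlapRingHom halg R U l m) =
      ΛO.comp (ρjl.symm.toAlgHom.toRingHom.comp Φlm.toRingHom) :=
    comp_chartRingHom_of_transition halg (U j).2 (U l).2 (isAffineOpen_inf₂ U b hb j l) (chartProj R U j) rfl
      (chartProj R U l) rfl
      (X.left.presheaf.map (homOfLE (inf_le_left : (U j).1 ⊓ (U l).1 ≤ (U j).1)).op (b j m))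
      (inf_eq_basicOpen_map U b hb inf_le_left m) hV'jl hV'lm
      (chartOverlap_le R U j l) (overlapRingHom_tmul_one halg R U j l) (overlapRingHom_one_tmul halg R U j l)
      (chartOverlap_le R U l m) (overlapRingHom_tmul_one halg R U l m) (overlapRingHom_one_tmul halg R U l m)
      (ψ j l) hψjl (baseChangeRight_tmul halg R U j l) a ha b' hb'' hO hΛO hΛO' hΦjl hΦlm hρjl
  -- §D the reading map `Γ(X', V_jlm) → Γ(O)` through chart `j` is injective
  have hpre : (deformationGlueDatum halg R U b hb ψ 𝔫 h𝔫 hψ hcoc).glueData.ι j ⁻¹ᵁ (((deformationGlueDatum halg R U b hb ψ 𝔫 h𝔫 hψ hcoc).glueData.ι j).opensRange ⊓ ((deformationGlueDatum halg R U b hb ψ 𝔫 h𝔫 hψ hcoc).glueData.ι l).opensRange ⊓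
      ((deformationGlueDatum halg R U b hb ψ 𝔫 h𝔫 hψ hcoc).glueData.ι m).opensRange) = O := by
    rw [Scheme.Hom.preimage_inf, Scheme.Hom.preimage_inf, Scheme.Hom.preimage_opensRange, top_inf_eq,
      glued_preimage_opensRange, glued_preimage_opensRange, hOdef]
  have hF : ⊤ ≤ (O.ι ≫ (deformationGlueDatum halg R U b hb ψ 𝔫 h𝔫 hψ hcoc).glueData.ι j) ⁻¹ᵁ (((deformationGlueDatum halg R U b hb ψ 𝔫 h𝔫 hψ hcoc).glueData.ι j).opensRange ⊓ ((deformationGlueDatum halg R U b hb ψ 𝔫 h𝔫 hψ hcoc).glueData.ι l).opensRange ⊓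
      ((deformationGlueDatum halg R U b hb ψ 𝔫 h𝔫 hψ hcoc).glueData.ι m).opensRange) := by
    rw [Scheme.Hom.comp_preimage, hpre, Scheme.Opens.ι_preimage_self]
  have hFrange : (O.ι ≫ (deformationGlueDatum halg R U b hb ψ 𝔫 h𝔫 hψ hcoc).glueData.ι j).opensRange = ((deformationGlueDatum halg R U b hb ψ 𝔫 h𝔫 hψ hcoc).glueData.ι j).opensRange ⊓
      ((deformationGlueDatum halg R U b hb ψ 𝔫 h𝔫 hψ hcoc).glueData.ι l).opensRange ⊓ ((deformationGlueDatum halg R U b hb ψ 𝔫 h𝔫 hψ hcoc).glueData.ι m).opensRange := by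
    rw [Scheme.Hom.opensRange_comp, Scheme.Opens.opensRange_ι, ← hpre, Scheme.Hom.image_preimage_eq_opensRange_inf,
      ← inf_assoc, ← inf_assoc, inf_idem]
  haveI := isIso_appLE_top_of_opensRange_eq _ _ hFrange hF
  have hinj : Function.Injective ((O.ι ≫ (deformationGlueDatum halg R U b hb ψ 𝔫 h𝔫 hψ hcoc).glueData.ι j).appLE _ ⊤ hF) :=
    (ConcreteCategory.bijective_of_isIso _).1
  -- §E the three readings through chart `j`
  have hFa : O.ι ≫ (deformationGlueDatum halg R U b hb ψ 𝔫 h𝔫 hψ hcoc).glueData.ι j = a ≫ ((chartOverlap R U j l).ι ≫ (deformationGlueDatum halg R U b hb ψ 𝔫 h𝔫 hψ hcoc).glueData.ι j) := by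
    rw [← Category.assoc, ha]
  have hFc : O.ι ≫ (deformationGlueDatum halg R U b hb ψ 𝔫 h𝔫 hψ hcoc).glueData.ι j = c ≫ ((chartOverlap R U j m).ι ≫ (deformationGlueDatum halg R U b hb ψ 𝔫 h𝔫 hψ hcoc).glueData.ι j) := by
    rw [← Category.assoc, hc]
  have hFb : O.ι ≫ (deformationGlueDatum halg R U b hb ψ 𝔫 h𝔫 hψ hcoc).glueData.ι j = b' ≫ ((chartOverlap R U l m).ι ≫ (deformationGlueDatum halg R U b hb ψ 𝔫 h𝔫 hψ hcoc).glueData.ι l) := by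
    have e := OpensGlueDatum.t_ι (deformationGlueDatum halg R U b hb ψ 𝔫 h𝔫 hψ hcoc) j l
    change transitionMap halg R U ψ j l ≫ (deformationGlueDatum halg R U b hb ψ 𝔫 h𝔫 hψ hcoc).glueData.ι l = (chartOverlap R U j l).ι ≫ (deformationGlueDatum halg R U b hb ψ 𝔫 h𝔫 hψ hcoc).glueData.ι j at e
    rw [← ha, Category.assoc, ← e, ← Category.assoc, ← hb', Category.assoc]
  -- reading of a restricted section = `appTop` of the test morphism applied to the chart reading
  have read : ∀ {C' : Scheme.{u}} (g : C' ⟶ (deformationGlueDatum halg R U b hb ψ 𝔫 h𝔫 hψ hcoc).glueData.glued) [IsOpenImmersion g] (q : (O : Scheme.{u}) ⟶ C')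
      (hq : O.ι ≫ (deformationGlueDatum halg R U b hb ψ 𝔫 h𝔫 hψ hcoc).glueData.ι j = q ≫ g) (V : (deformationGlueDatum halg R U b hb ψ 𝔫 h𝔫 hψ hcoc).glueData.glued.Opens) (hg : ⊤ ≤ g ⁻¹ᵁ V)
      (hle : ((deformationGlueDatum halg R U b hb ψ 𝔫 h𝔫 hψ hcoc).glueData.ι j).opensRange ⊓ ((deformationGlueDatum halg R U b hb ψ 𝔫 h𝔫 hψ hcoc).glueData.ι l).opensRange ⊓ ((deformationGlueDatum halg R U b hb ψ 𝔫 h𝔫 hψ hcoc).glueData.ι m).opensRange ≤ V)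
      (x : Γ((deformationGlueDatum halg R U b hb ψ 𝔫 h𝔫 hψ hcoc).glueData.glued, V)),
      (O.ι ≫ (deformationGlueDatum halg R U b hb ψ 𝔫 h𝔫 hψ hcoc).glueData.ι j).appLE _ ⊤ hF ((deformationGlueDatum halg R U b hb ψ 𝔫 h𝔫 hψ hcoc).glueData.glued.presheaf.map (homOfLE hle).op x) =
        q.appTop (g.appLE V ⊤ hg x) := by
    intro C' g _ q hq V hg hle x
    rw [← CommRingCat.comp_apply, Scheme.Hom.map_appLE, appLE_eq_of_eq hq, ← CommRingCat.comp_apply,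
      Scheme.Hom.appTop, Scheme.Hom.app_eq_appLE, Scheme.Hom.appLE_comp_appLE]
    rfl
  have r₁ := read _ a hFa _ (top_le_preimage_opensRange_inf halg R U b hb ψ 𝔫 h𝔫 hψ hcoc j l) inf_le_left (s j l)
  have r₂ := read _ b' hFb _ (top_le_preimage_opensRange_inf halg R U b hb ψ 𝔫 h𝔫 hψ hcoc l m)
    (le_inf (inf_le_left.trans inf_le_right) inf_le_right) (s l m)
  have r₃ := read _ c hFc _ (top_le_preimage_opensRange_inf halg R U b hb ψ 𝔫 h𝔫 hψ hcoc j m)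
    (le_inf (inf_le_left.trans inf_le_left) inf_le_right) (s j m)
  rw [hs j l] at r₁
  rw [hs l m] at r₂
  rw [hs j m] at r₃
  -- §F conclude by injectivity of the reading
  apply hinj
  rw [map_mul, r₁, r₂, r₃]
  change (a.appTop.hom.comp (overlapRingHom halg R U j l)) (G j l) *
      (b'.appTop.hom.comp (overlapRingHom halg R U l m)) (G l m) =
    (c.appTop.hom.comp (overlapRingHom halg R U j m)) (G j m)
  rw [ejl, elm, ejm]
  change ΛO (Φjl (G j l)) * ΛO (ρjl.symm (Φlm (G l m))) = ΛO (Φjm (G j m))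
  rw [← map_mul, hG]

end D1A1

end Literature.AlgebraicGeometry.Deformation

end
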